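import Summits.HodgeConjecture.HodgeConjecture.Theorems.HodgeLocusCensusSigmaFamilySmoothK5

-- `Summit.HodgeConjecture.HodgeConjecture.…` (summit = sub-problem for this single-conjunct summit) trips `linter.dupNamespace`
-- on every declaration; the duplication is the tree's naming convention (D-0017), as in the sibling census sheets.
set_option linter.dupNamespace false

/-!
# Hodge-locus census, cell (10, 4, 4) — ROUTE T4 of ENGINE B's smoothness certificate for the Σ-member `F_N = N·F₀ + F₁`,
# `N = 1, …, 6`: CHART LEMMAS (root split, stratum-I cover, stratum-IV chart) — companion of `HodgeLocusCensusSigmaFamilyRouteT4`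

certified instances and evidence bearing on the general Hodge conjecture; no claim.

ENGINE B (unit `pub-hlocus-ivhs-2`, gen 37).  Def-free; imports only the family anchor `HodgeLocusCensusSigmaFamilySmoothK5`.
This is the first of two files (the tree caps Theorems files at 400 lines); the METHOD OF RECORD, the TRANSCRIPTION statement
(R-L265 (a)) and WHAT IS / IS NOT kernel-checked are stated in full in the module docstring of the main file
`HodgeLocusCensusSigmaFamilyRouteT4` (theorem `routeT4_cover`), which imports this one.  In brief: `F_N = N·(Σ_{j<5} (y_j x_j³ + y_j⁴)
+ a³b + ab³) − (y₀x₁²x₂ + y₁x₂²x₃ + y₂x₃²x₄ + y₃x₀x₄²) + ab·x₀x₁ ⊂ ℙ¹¹`, `K` any field with `2 ≠ 0`, `3 ≠ 0`, `N ≠ 0` in `K`,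
`c₁, c₂, c₃ ∈ K` the roots of `4T³ + 1` (`e₁ = e₂ = 0`, `4e₃ = −1`).

* `root_split`: `x³ + 4y³ = 0 ⇒ y = cᵢ·x` for some `i`.
* `caseI_cover`: stratum I (`a = b = 0`) — a non-zero zero of `∇G`, `G = F_N|_{a=b=0}`, yields a `K`-point of one of the three
  registered chart systems `I/x4=1/cᵢ` (hypothesis `hI`: the generators of `runT.py` md5 edac93efb12ae6d7ebb098e35f57200a
  `systems_T`, transcribed term by term in registered order, unknowns `X0 X1 X2 X3 Y0 Y1 Y2 Y3`); the eight c-free charts of the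
  registered 17-ideal list (flag charts `x₄ = 0, …`; charts `x = 0, y_j = 1`) are discharged inside the proof using only `6N ≠ 0`.
* `caseIV_chart`: stratum IV (`ab ≠ 0`), reduction R2 — with `b = ε·a`, `ε = ±1`, the bracket partial gives `x₀x₁ = −4Na²`, hence
  `x₁ ≠ 0`, and the x/y-partials become the cubic system `T_ε`; dehomogenised at `x₁ = 1` with `y₄ = cᵢ·x₄` this is a `K`-point of
  `T±/x1=1/cᵢ` (hypothesis `hT`: `runT4.py` md5 633b526ed2957f2f397b2cede112e34f `T_eps_system` + `systems_T4`, the residue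
  `r = (−ε)(4N)⁻¹ mod p` written as the field element `− ε / (4 * N)`; unknowns `X0 X2 X3 X4 Y0 Y1 Y2 Y3`).

The Gröbner-basis facts '1 ∈ (chart ideal) over 𝔽_p' (COMPUTATION OF RECORD, kit jobs j216653/4/5, j217741) and the transfer
'𝔽̄_p-smooth ⇒ ℂ-smooth' (PAPER STEP OF RECORD, `ENGINEB-g35.md` §1.9) are NOT Lean statements, here or in the main file.
-/

namespace Summit.HodgeConjecture.HodgeConjecture.HodgeLocus.Census.SigmaFamilyRouteT4

section Field
variable {K : Type*} [Field K]

/-- ROOT SPLIT.  If `c₁, c₂, c₃` have elementary symmetric functions `0, 0, −1/4` (so that `4T³ + 1 = 4∏(T − cᵢ)`;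
ENGINE B self-check SC3) and `2 ≠ 0` in `K`, then `x³ + 4y³ = 0` forces `y = cᵢ·x` for some `i`. -/
theorem root_split (c₁ c₂ c₃ x y : K) (h2 : (2 : K) ≠ 0)
    (he1 : c₁ + c₂ + c₃ = 0) (he2 : c₁ * c₂ + c₁ * c₃ + c₂ * c₃ = 0) (he3 : 4 * (c₁ * c₂ * c₃) = -1)
    (h : x ^ 3 + 4 * y ^ 3 = 0) : y = c₁ * x ∨ y = c₂ * x ∨ y = c₃ * x := by
  have h4 : (4 : K) ≠ 0 := by
    have e : (4 : K) = 2 * 2 := by norm_num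
    rw [e]; exact mul_ne_zero h2 h2
  have hfac : 4 * ((y - c₁ * x) * (y - c₂ * x) * (y - c₃ * x)) = 0 := by
    linear_combination h + (-(4 * y ^ 2 * x)) * he1 + (4 * y * x ^ 2) * he2 + (-(x ^ 3)) * he3
  have h0 : (y - c₁ * x) * (y - c₂ * x) * (y - c₃ * x) = 0 := by
    rcases mul_eq_zero.mp hfac with h' | h'
    · exact absurd h' h4
    · exact h'
  rcases mul_eq_zero.mp h0 with h12 | h3'
  · rcases mul_eq_zero.mp h12 with h1' | h2'
    · exact Or.inl (by linear_combination h1')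
    · exact Or.inr (Or.inl (by linear_combination h2'))
  · exact Or.inr (Or.inr (by linear_combination h3'))

/-- CASE I COVER (strata I, and by R1 also II/III, of route T4), `k′ = 5`, `d = 4`.
`G = N Σ_j (y_j x_j³ + y_j⁴) − y₀x₁²x₂ − y₁x₂²x₃ − y₂x₃²x₄ − y₃x₀x₄²`; hypotheses `G0 … G4, H0 … H4` = the ten partials
`∂G/∂x₀ … ∂G/∂x₄, ∂G/∂y₀ … ∂G/∂y₄` vanish at a point `(x, y) ≠ 0` of `K¹⁰`.  Conclusion: one of the three registered chart
systems `I/x4=1/c=cᵢ` (y₄ := cᵢ·x₄, then x₄ := 1; unknowns X0 X1 X2 X3 Y0 Y1 Y2 Y3) has a `K`-point — contradicting `hI`.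
The four flag charts (x₄ = 0, x₃ = 1; …; x₄ = … = x₁ = 0, x₀ = 1) and the four charts `x = 0, y_j = 1` of the registered
17-ideal list need NO hypothesis: each is discharged here by a coordinate cascade using only `6N ≠ 0`. -/
theorem caseI_cover (N c₁ c₂ c₃ : K) (hN : N ≠ 0) (h2 : (2 : K) ≠ 0) (h3 : (3 : K) ≠ 0)
    (he1 : c₁ + c₂ + c₃ = 0) (he2 : c₁ * c₂ + c₁ * c₃ + c₂ * c₃ = 0) (he3 : 4 * (c₁ * c₂ * c₃) = -1)
    (hI : ∀ c : K, (c = c₁ ∨ c = c₂ ∨ c = c₃) → ∀ X0 X1 X2 X3 Y0 Y1 Y2 Y3 : K,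
      ¬ (3 * N * X0 ^ 2 * Y0 - Y3 = 0 ∧
         3 * N * X1 ^ 2 * Y1 - 2 * Y0 * X1 * X2 = 0 ∧
         3 * N * X2 ^ 2 * Y2 - Y0 * X1 ^ 2 - 2 * Y1 * X2 * X3 = 0 ∧
         3 * N * X3 ^ 2 * Y3 - Y1 * X2 ^ 2 - 2 * Y2 * X3 = 0 ∧
         3 * N * c - Y2 * X3 ^ 2 - 2 * Y3 * X0 = 0 ∧
         N * (X0 ^ 3 + 4 * Y0 ^ 3) - X1 ^ 2 * X2 = 0 ∧
         N * (X1 ^ 3 + 4 * Y1 ^ 3) - X2 ^ 2 * X3 = 0 ∧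
         N * (X2 ^ 3 + 4 * Y2 ^ 3) - X3 ^ 2 = 0 ∧
         N * (X3 ^ 3 + 4 * Y3 ^ 3) - X0 = 0))
    (x0 x1 x2 x3 x4 y0 y1 y2 y3 y4 : K)
    (hne : ¬ (x0 = 0 ∧ x1 = 0 ∧ x2 = 0 ∧ x3 = 0 ∧ x4 = 0 ∧ y0 = 0 ∧ y1 = 0 ∧ y2 = 0 ∧ y3 = 0 ∧ y4 = 0))
    (G0 : 3 * N * x0 ^ 2 * y0 - y3 * x4 ^ 2 = 0)
    (G1 : 3 * N * x1 ^ 2 * y1 - 2 * y0 * x1 * x2 = 0)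
    (G2 : 3 * N * x2 ^ 2 * y2 - y0 * x1 ^ 2 - 2 * y1 * x2 * x3 = 0)
    (G3 : 3 * N * x3 ^ 2 * y3 - y1 * x2 ^ 2 - 2 * y2 * x3 * x4 = 0)
    (G4 : 3 * N * x4 ^ 2 * y4 - y2 * x3 ^ 2 - 2 * y3 * x0 * x4 = 0)
    (H0 : N * (x0 ^ 3 + 4 * y0 ^ 3) - x1 ^ 2 * x2 = 0)
    (H1 : N * (x1 ^ 3 + 4 * y1 ^ 3) - x2 ^ 2 * x3 = 0)
    (H2 : N * (x2 ^ 3 + 4 * y2 ^ 3) - x3 ^ 2 * x4 = 0)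
    (H3 : N * (x3 ^ 3 + 4 * y3 ^ 3) - x0 * x4 ^ 2 = 0)
    (H4 : N * (x4 ^ 3 + 4 * y4 ^ 3) = 0) : False := by
  have h4 : (4 : K) ≠ 0 := by
    have e : (4 : K) = 2 * 2 := by norm_num
    rw [e]; exact mul_ne_zero h2 h2
  have h3N : 3 * N ≠ 0 := mul_ne_zero h3 hN
  have h4N : 4 * N ≠ 0 := mul_ne_zero h4 hN
  -- a cube that vanishes has vanishing base
  have cube : ∀ t : K, t ^ 3 = 0 → t = 0 := fun t ht => pow_eq_zero_iff (by norm_num) |>.mp ht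
  have sq : ∀ t : K, t ^ 2 = 0 → t = 0 := fun t ht => pow_eq_zero_iff (by norm_num) |>.mp ht
  by_cases hx4 : x4 = 0
  · -- FLAG x₄ = 0: then y₄ = 0 and the cascade; no chart hypothesis is used on this branch.
    subst hx4
    have hy4 : y4 = 0 := by
      have h' : (4 * N) * y4 ^ 3 = 0 := by linear_combination H4
      rcases mul_eq_zero.mp h' with h'' | h''
      · exact absurd h'' h4N
      · exact cube _ h''
    by_cases hx3 : x3 = 0
    · subst hx3
      by_cases hx2 : x2 = 0
      · subst hx2
        by_cases hx1 : x1 = 0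
        · subst hx1
          by_cases hx0 : x0 = 0
          · subst hx0
            -- x = 0: the charts 'I/x=0,yj=1' — 4N y_j³ = 0 forces y = 0, contradicting (x,y) ≠ 0
            have hy0 : y0 = 0 := by
              have h' : (4 * N) * y0 ^ 3 = 0 := by linear_combination H0
              rcases mul_eq_zero.mp h' with h'' | h''
              · exact absurd h'' h4N
              · exact cube _ h''
            have hy1 : y1 = 0 := by
              have h' : (4 * N) * y1 ^ 3 = 0 := by linear_combination H1
              rcases mul_eq_zero.mp h' with h'' | h''
              · exact absurd h'' h4N
              · exact cube _ h''
            have hy2 : y2 = 0 := by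
              have h' : (4 * N) * y2 ^ 3 = 0 := by linear_combination H2
              rcases mul_eq_zero.mp h' with h'' | h''
              · exact absurd h'' h4N
              · exact cube _ h''
            have hy3 : y3 = 0 := by
              have h' : (4 * N) * y3 ^ 3 = 0 := by linear_combination H3
              rcases mul_eq_zero.mp h' with h'' | h''
              · exact absurd h'' h4N
              · exact cube _ h''
            exact hne ⟨rfl, rfl, rfl, rfl, rfl, hy0, hy1, hy2, hy3, hy4⟩
          · -- chart x₀ = 1 (x₁ = … = x₄ = 0): ∂x₀ ⇒ y₀ = 0, ∂y₀ ⇒ N x₀³ = 0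
            have hy0 : y0 = 0 := by
              have h' : (3 * N) * x0 ^ 2 * y0 = 0 := by linear_combination G0
              rcases mul_eq_zero.mp h' with h'' | h''
              · rcases mul_eq_zero.mp h'' with h3' | h3'
                · exact absurd h3' h3N
                · exact absurd (sq _ h3') hx0
              · exact h''
            have h' : N * x0 ^ 3 = 0 := by rw [hy0] at H0; linear_combination H0
            rcases mul_eq_zero.mp h' with h'' | h''
            · exact hN h''
            · exact hx0 (cube _ h'')
        · -- chart x₁ = 1 (x₂ = x₃ = x₄ = 0): ∂x₂ ⇒ y₀ = 0, ∂x₁ ⇒ y₁ = 0, ∂y₁ ⇒ N x₁³ = 0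
          have hy0 : y0 = 0 := by
            have h' : y0 * x1 ^ 2 = 0 := by linear_combination -G2
            rcases mul_eq_zero.mp h' with h'' | h''
            · exact h''
            · exact absurd (sq _ h'') hx1
          have hy1 : y1 = 0 := by
            have h' : (3 * N) * x1 ^ 2 * y1 = 0 := by rw [hy0] at G1; linear_combination G1
            rcases mul_eq_zero.mp h' with h'' | h''
            · rcases mul_eq_zero.mp h'' with h3' | h3'
              · exact absurd h3' h3N
              · exact absurd (sq _ h3') hx1
            · exact h''
          have h' : N * x1 ^ 3 = 0 := by rw [hy1] at H1; linear_combination H1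
          rcases mul_eq_zero.mp h' with h'' | h''
          · exact hN h''
          · exact hx1 (cube _ h'')
      · -- chart x₂ = 1 (x₃ = x₄ = 0): ∂x₃ ⇒ y₁ = 0, ∂y₁ ⇒ x₁ = 0, ∂x₂ ⇒ y₂ = 0, ∂y₂ ⇒ N x₂³ = 0
        have hy1 : y1 = 0 := by
          have h' : y1 * x2 ^ 2 = 0 := by linear_combination -G3
          rcases mul_eq_zero.mp h' with h'' | h''
          · exact h''
          · exact absurd (sq _ h'') hx2
        have hx1 : x1 = 0 := by
          have h' : N * x1 ^ 3 = 0 := by rw [hy1] at H1; linear_combination H1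
          rcases mul_eq_zero.mp h' with h'' | h''
          · exact absurd h'' hN
          · exact cube _ h''
        have hy2 : y2 = 0 := by
          have h' : (3 * N) * x2 ^ 2 * y2 = 0 := by rw [hy1, hx1] at G2; linear_combination G2
          rcases mul_eq_zero.mp h' with h'' | h''
          · rcases mul_eq_zero.mp h'' with h3' | h3'
            · exact absurd h3' h3N
            · exact absurd (sq _ h3') hx2
          · exact h''
        have h' : N * x2 ^ 3 = 0 := by rw [hy2] at H2; linear_combination H2
        rcases mul_eq_zero.mp h' with h'' | h''
        · exact hN h''
        · exact hx2 (cube _ h'')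
    · -- chart x₃ = 1 (x₄ = 0, hence y₄ = 0): ∂x₄ ⇒ y₂ = 0, ∂y₂ ⇒ x₂ = 0, ∂x₃ ⇒ y₃ = 0, ∂y₃ ⇒ N x₃³ = 0
      have hy2 : y2 = 0 := by
        have h' : y2 * x3 ^ 2 = 0 := by rw [hy4] at G4; linear_combination -G4
        rcases mul_eq_zero.mp h' with h'' | h''
        · exact h''
        · exact absurd (sq _ h'') hx3
      have hx2 : x2 = 0 := by
        have h' : N * x2 ^ 3 = 0 := by rw [hy2] at H2; linear_combination H2
        rcases mul_eq_zero.mp h' with h'' | h''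
        · exact absurd h'' hN
        · exact cube _ h''
      have hy3 : y3 = 0 := by
        have h' : (3 * N) * x3 ^ 2 * y3 = 0 := by rw [hy2, hx2] at G3; linear_combination G3
        rcases mul_eq_zero.mp h' with h'' | h''
        · rcases mul_eq_zero.mp h'' with h3' | h3'
          · exact absurd h3' h3N
          · exact absurd (sq _ h3') hx3
        · exact h''
      have h' : N * x3 ^ 3 = 0 := by rw [hy3] at H3; linear_combination H3
      rcases mul_eq_zero.mp h' with h'' | h''
      · exact hN h''
      · exact hx3 (cube _ h'')
  · -- x₄ ≠ 0: root split y₄ = c·x₄, then the chart x₄ = 1 (scale by w = x₄⁻¹)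
    have hxy : x4 ^ 3 + 4 * y4 ^ 3 = 0 := by
      rcases mul_eq_zero.mp H4 with h' | h'
      · exact absurd h' hN
      · exact h'
    obtain ⟨c, hcmem, hy4⟩ : ∃ c, (c = c₁ ∨ c = c₂ ∨ c = c₃) ∧ y4 = c * x4 := by
      rcases root_split c₁ c₂ c₃ x4 y4 h2 he1 he2 he3 hxy with h' | h' | h'
      · exact ⟨c₁, Or.inl rfl, h'⟩
      · exact ⟨c₂, Or.inr (Or.inl rfl), h'⟩
      · exact ⟨c₃, Or.inr (Or.inr rfl), h'⟩
    have hu : x4 * x4⁻¹ = 1 := mul_inv_cancel₀ hx4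
    set w := x4⁻¹ with hw
    apply hI c hcmem (x0 * w) (x1 * w) (x2 * w) (x3 * w) (y0 * w) (y1 * w) (y2 * w) (y3 * w)
    refine ⟨?_, ?_, ?_, ?_, ?_, ?_, ?_, ?_, ?_⟩
    · linear_combination (w ^ 3) * G0 + (y3 * w * (x4 * w + 1)) * hu
    · linear_combination (w ^ 3) * G1
    · linear_combination (w ^ 3) * G2
    · linear_combination (w ^ 3) * G3 + (2 * y2 * x3 * w ^ 2) * hu
    · linear_combination (w ^ 3) * G4
        + (-(3 * N * c * (1 + x4 * w + x4 ^ 2 * w ^ 2)) + 2 * y3 * x0 * w ^ 2) * hu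
        + (-(3 * N * x4 ^ 2 * w ^ 3)) * hy4
    · linear_combination (w ^ 3) * H0
    · linear_combination (w ^ 3) * H1
    · linear_combination (w ^ 3) * H2 + (x3 ^ 2 * w ^ 2) * hu
    · linear_combination (w ^ 3) * H3 + (x0 * w * (x4 * w + 1)) * hu


/-- CASE IV CHART (stratum `ab ≠ 0` of route T4, reduction R2), `k′ = 5`, `d = 4`.  With `b = ε·a` (`ε = ±1`, `a ≠ 0`) and
the bracket equation `N(3a² + b²) + x₀x₁ = 0` one gets `x₀x₁ = −4Na²`, hence `x₁ ≠ 0`, and the x/y-partials of `F_N` become the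
homogeneous cubic system `T_ε` (∇G with `∂/∂x₀, ∂/∂x₁` corrected by `−(ε/4N)·x₀x₁², −(ε/4N)·x₀²x₁`); after the root split
`y₄ = c·x₄` and scaling by `x₁⁻¹` the point solves the registered chart system `T±/x1=1/c` — contradicting `hT`. -/
theorem caseIV_chart (N c₁ c₂ c₃ ε : K) (hN : N ≠ 0) (h2 : (2 : K) ≠ 0)
    (he1 : c₁ + c₂ + c₃ = 0) (he2 : c₁ * c₂ + c₁ * c₃ + c₂ * c₃ = 0) (he3 : 4 * (c₁ * c₂ * c₃) = -1)
    (hεmem : ε = 1 ∨ ε = -1)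
    (hT : ∀ ε' : K, (ε' = 1 ∨ ε' = -1) → ∀ c : K, (c = c₁ ∨ c = c₂ ∨ c = c₃) → ∀ X0 X2 X3 X4 Y0 Y1 Y2 Y3 : K,
      ¬ (3 * N * X0 ^ 2 * Y0 - Y3 * X4 ^ 2 - ε' / (4 * N) * X0 = 0 ∧
         3 * N * Y1 - 2 * Y0 * X2 - ε' / (4 * N) * X0 ^ 2 = 0 ∧
         3 * N * X2 ^ 2 * Y2 - Y0 - 2 * Y1 * X2 * X3 = 0 ∧
         3 * N * X3 ^ 2 * Y3 - Y1 * X2 ^ 2 - 2 * Y2 * X3 * X4 = 0 ∧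
         3 * N * c * X4 ^ 3 - Y2 * X3 ^ 2 - 2 * Y3 * X0 * X4 = 0 ∧
         N * (X0 ^ 3 + 4 * Y0 ^ 3) - X2 = 0 ∧
         N * (1 + 4 * Y1 ^ 3) - X2 ^ 2 * X3 = 0 ∧
         N * (X2 ^ 3 + 4 * Y2 ^ 3) - X3 ^ 2 * X4 = 0 ∧
         N * (X3 ^ 3 + 4 * Y3 ^ 3) - X0 * X4 ^ 2 = 0))
    (a b x0 x1 x2 x3 x4 y0 y1 y2 y3 y4 : K) (ha : a ≠ 0) (hb' : b = ε * a)
    (Ha' : N * (3 * a ^ 2 + b ^ 2) + x0 * x1 = 0)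
    (Hx0 : 3 * N * x0 ^ 2 * y0 - y3 * x4 ^ 2 + a * b * x1 = 0)
    (Hx1 : 3 * N * x1 ^ 2 * y1 - 2 * y0 * x1 * x2 + a * b * x0 = 0)
    (G2 : 3 * N * x2 ^ 2 * y2 - y0 * x1 ^ 2 - 2 * y1 * x2 * x3 = 0)
    (G3 : 3 * N * x3 ^ 2 * y3 - y1 * x2 ^ 2 - 2 * y2 * x3 * x4 = 0)
    (G4 : 3 * N * x4 ^ 2 * y4 - y2 * x3 ^ 2 - 2 * y3 * x0 * x4 = 0)
    (H0 : N * (x0 ^ 3 + 4 * y0 ^ 3) - x1 ^ 2 * x2 = 0)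
    (H1 : N * (x1 ^ 3 + 4 * y1 ^ 3) - x2 ^ 2 * x3 = 0)
    (H2 : N * (x2 ^ 3 + 4 * y2 ^ 3) - x3 ^ 2 * x4 = 0)
    (H3 : N * (x3 ^ 3 + 4 * y3 ^ 3) - x0 * x4 ^ 2 = 0)
    (H4 : N * (x4 ^ 3 + 4 * y4 ^ 3) = 0) : False := by
  have h4 : (4 : K) ≠ 0 := by
    have e : (4 : K) = 2 * 2 := by norm_num
    rw [e]; exact mul_ne_zero h2 h2
  have h4N : 4 * N ≠ 0 := mul_ne_zero h4 hN
  have hε : ε ^ 2 = 1 := by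
    rcases hεmem with h | h <;> subst h <;> norm_num
  -- the bracket equations: g = x₀x₁ = −4Na², hence x₁ ≠ 0
  have hg : x0 * x1 = -(4 * N * a ^ 2) := by
    linear_combination Ha' + (-(N * (b + ε * a))) * hb' + (-(N * a ^ 2)) * hε
  have hx1 : x1 ≠ 0 := by
    intro h0
    have h' : (4 * N) * a ^ 2 = 0 := by linear_combination hg - x0 * h0
    rcases mul_eq_zero.mp h' with h'' | h''
    · exact h4N h''
    · exact ha (pow_eq_zero_iff (by norm_num) |>.mp h'')
  have hr : ε / (4 * N) * (4 * N) = ε := by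
    rw [div_mul_eq_mul_div, mul_div_assoc, div_self h4N, mul_one]
  -- R2: the corrected components T_ε (homogeneous form)
  have T0 : 3 * N * x0 ^ 2 * y0 - y3 * x4 ^ 2 - ε / (4 * N) * (x0 * x1 ^ 2) = 0 := by
    linear_combination Hx0 + (-(a * x1)) * hb' + (-(ε / (4 * N) * x1)) * hg + (a ^ 2 * x1) * hr
  have T1 : 3 * N * x1 ^ 2 * y1 - 2 * y0 * x1 * x2 - ε / (4 * N) * (x0 ^ 2 * x1) = 0 := by
    linear_combination Hx1 + (-(a * x0)) * hb' + (-(ε / (4 * N) * x0)) * hg + (a ^ 2 * x0) * hr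
  -- root split
  have hxy : x4 ^ 3 + 4 * y4 ^ 3 = 0 := by
    rcases mul_eq_zero.mp H4 with h' | h'
    · exact absurd h' hN
    · exact h'
  obtain ⟨c, hcmem, hy4⟩ : ∃ c, (c = c₁ ∨ c = c₂ ∨ c = c₃) ∧ y4 = c * x4 := by
    rcases root_split c₁ c₂ c₃ x4 y4 h2 he1 he2 he3 hxy with h' | h' | h'
    · exact ⟨c₁, Or.inl rfl, h'⟩
    · exact ⟨c₂, Or.inr (Or.inl rfl), h'⟩
    · exact ⟨c₃, Or.inr (Or.inr rfl), h'⟩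
  -- dehomogenise at x₁ (scale by u = x₁⁻¹) and land in the registered chart system T_ε/x1=1/c
  have hu : x1 * x1⁻¹ = 1 := mul_inv_cancel₀ hx1
  set u := x1⁻¹ with hu_def
  apply hT ε hεmem c hcmem (x0 * u) (x2 * u) (x3 * u) (x4 * u) (y0 * u) (y1 * u) (y2 * u) (y3 * u)
  refine ⟨?_, ?_, ?_, ?_, ?_, ?_, ?_, ?_, ?_⟩
  · linear_combination (u ^ 3) * T0 + (ε / (4 * N) * x0 * u * (x1 * u + 1)) * hu
  · linear_combination (u ^ 3) * T1
      + (-(3 * N * y1 * u * (1 + x1 * u) - 2 * y0 * x2 * u ^ 2 - ε / (4 * N) * x0 ^ 2 * u ^ 2)) * hu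
  · linear_combination (u ^ 3) * G2 + (y0 * u * (x1 * u + 1)) * hu
  · linear_combination (u ^ 3) * G3
  · linear_combination (u ^ 3) * G4 + (-(3 * N * x4 ^ 2 * u ^ 3)) * hy4
  · linear_combination (u ^ 3) * H0 + (x2 * u * (x1 * u + 1)) * hu
  · linear_combination (u ^ 3) * H1 + (-(N * (1 + x1 * u + x1 ^ 2 * u ^ 2))) * hu
  · linear_combination (u ^ 3) * H2
  · linear_combination (u ^ 3) * H3

end Field

end Summit.HodgeConjecture.HodgeConjecture.HodgeLocus.Census.SigmaFamilyRouteT4
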